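import Summits.QuantumFields.YangMills.Theorems.RecentredCoverTransferCellTranslation
import Summits.QuantumFields.YangMills.Theorems.PencilRigidityNPointIsotropyRiemannSum
import Summits.QuantumFields.YangMills.Theorems.PencilRigidityCurvatureKernelBoundChartDerivativeBoundsTensor
import Summits.QuantumFields.YangMills.Theorems.LangevinControlUVOSLegsFromFemtoAndGapStubAssemblyUniformBoundPrep
import Literature.Analysis.FluidPDE.NewtonKernel
import Literature.MathematicalPhysics.QuantumLattice.RandomField
import HarnessLib

/-!
# The KILL CRITERION of route `RecentredCoverTransfer` as a theorem: the `n = 2` clause of `CoverRecentring` FORCES the mean-shift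
# rate `a_k⁻⁴(m_C − m_T) → 0` (kit for crux `OnePointRate`, stmt-QuantumFields-23142, LINE g9-A/C of planner ym-idea-1 g9)

Helper file (`--supports stmt-QuantumFields-23142 --as helper`; width seat `ym-line-sfw-p2-w3` g28 of cell ym-idea-1, free hands).
Route-independent, definition-free, 0 sorry.  The route thesis says «for `n = 2` [CoverRecentring] is EXACTLY the scalar statement
`Δ_k = o(a_k⁴)` … against `∫F ≠ 0`» and files the KILL CRITERION «a scheme / cell sequence along which `a_k⁻⁴·(m_T − m_C)` does NOT
tend to `0` refutes `CoverRecentring` (its `n = 2` clause)».  `Theorems/RecentredCoverTransferMeanShiftTwoPoint` proved the direction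
`a_k⁻⁴Δ_k → 0 ⟹ n = 2 clause`; this file proves the converse, so that the equivalence is a tree theorem:

* §1 `exists_bumpPair` — two real Schwartz bumps `g, h` on `ℝ⁴` with DISJOINT compact supports inside `closedBall 0 4` and
  `0 < ∫g`, `0 < ∫h` (a radial cutoff and its translate; `Literature.Analysis.FluidPDE.radialCutoff`);
* §2 `tensor_apply_eq_zero_of_not_mem_box`, `sum_piFinset_tensor_eq_mul` — the witness `F = g ⊗ h ∈ ⁰𝒮((ℝ⁴)²)` (off-diagonal by
  disjointness, compactly supported), its lattice sums factor: `Σ_{(x,y) ∈ box²} F(a x, a y) = (Σ_x g(a x))·(Σ_y h(a y))`, and vanish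
  off `box(L)²` once `4 < a(L+1)`;
* §3 ★ `tendsto_meanShift_of_dist_two_recentre` — for ANY cells `C_k` with `box(L_k) ⊆ reps_k`, spacings `a_k → 0⁺` with
  `a_k L_k → ∞`, couplings `β_k`, bounded measurable observable `O` and comparison centrings `m_k`: if
  `dist_{C_k}(a_k·; m_{C_k}) F − dist_{C_k}(a_k·; m_k) F → 0` for every off-diagonal compactly supported `F` on `(ℝ⁴)²`, then
  `a_k⁻⁴·(m_{C_k}(O) − m_k) → 0`.  PROOF: by the `n = 2` identity (`dist_two_sub_dist_two`) the difference at the witness is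
  `−Δ_k²·Σ_{reps²} F(a_k·)`, and `a_k⁸·Σ F(a_k·) → (∫g)(∫h) > 0` (`tendsto_riemannSum_box`), so `(a_k⁻⁴Δ_k)² → 0`;
* §4 ★ `onePointRate_conclusion_of_coverRecentring_two` — the same in the binders of the route (`r.curvature`, `sch`, `wilsonTorusMean`):
  the `n = 2` clause of `CoverRecentring` along `(sch, C)` implies the conclusion of `OnePointRate` along `(sch, C)`.

HONEST FRAMING: neither `OnePointRate` (23142) nor `CoverRecentring` (23105) is proved or refuted here — the file proves that they stand or
fall TOGETHER at `n = 2`; no item is closed; no summit, rung (R2d ROT is a RECORD rung) or mass gap is proved.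
-/

set_option autoImplicit false

noncomputable section

open scoped SchwartzMap BigOperators ENNReal
open MeasureTheory Filter Topology
open Literature.MathematicalPhysics.QuantumFieldTheory Literature.MathematicalPhysics.QuantumLattice
open Literature.MathematicalPhysics.AQFT
open Literature.Probability.LatticeModels (Site box mem_box)
open Literature.Analysis.FluidPDE (radialCutoff radialCutoff_contDiff radialCutoff_nonneg radialCutoff_eq_one
  hasCompactSupport_radialCutoff tsupport_radialCutoff_subset)
open Summit.QuantumFields.YangMills.Theorems.ROT (PeriodCell)
open Summit.QuantumFields.YangMills.Theorems.NPointIsotropy.ComplexRotationBandlimit (tendsto_riemannSum_box)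
open Summit.QuantumFields.YangMills.Theorems.CurvatureKernel (isOffDiagonal_tensorFin_two_of_disjoint)
open Summit.QuantumFields.YangMills.Theorems.OSLegsFromFemtoAndGap (mul_norm_le_norm_smul_siteToE)

namespace Summit.QuantumFields.YangMills.Theorems.RecentredCoverTransfer

/-! ## §1 Two bumps with disjoint compact supports and positive integrals -/

/-- The topological support of `ofRealTest g` is that of `g`. [folklore] -/
theorem tsupport_ofRealTest (g : 𝓢(EuclideanSpace ℝ (Fin 4), ℝ)) :
    tsupport ((ofRealTest g : 𝓢(EuclideanSpace ℝ (Fin 4), ℂ)) : EuclideanSpace ℝ (Fin 4) → ℂ) =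
      tsupport (g : EuclideanSpace ℝ (Fin 4) → ℝ) := by
  unfold tsupport
  congr 1
  ext x
  simp [Function.mem_support, ofRealTest_apply]

/-- **A bump pair**: real Schwartz `g, h ≥ 0` on `ℝ⁴` with disjoint compact supports inside `closedBall 0 4` and positive integrals
(`g` = radial cutoff equal to `1` on `closedBall 0 (1/2)` and supported in `closedBall 0 1`; `h` = its translate by a vector of
norm `3`). [folklore] -/
theorem exists_bumpPair :
    ∃ g h : 𝓢(EuclideanSpace ℝ (Fin 4), ℝ),
      Disjoint (tsupport (g : EuclideanSpace ℝ (Fin 4) → ℝ)) (tsupport (h : EuclideanSpace ℝ (Fin 4) → ℝ)) ∧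
      tsupport (g : EuclideanSpace ℝ (Fin 4) → ℝ) ⊆ Metric.closedBall 0 4 ∧
      tsupport (h : EuclideanSpace ℝ (Fin 4) → ℝ) ⊆ Metric.closedBall 0 4 ∧
      0 < ∫ x, g x ∧ 0 < ∫ x, h x := by
  have h0 : (0 : ℝ) ≤ 1 / 2 := by norm_num
  have h1 : (1 : ℝ) / 2 < 1 := by norm_num
  set g : 𝓢(EuclideanSpace ℝ (Fin 4), ℝ) :=
    (hasCompactSupport_radialCutoff (E := EuclideanSpace ℝ (Fin 4)) h0 h1).toSchwartzMap
      (radialCutoff_contDiff (1 / 2) 1) with hg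
  have hgapp : ∀ x, g x = radialCutoff (1 / 2) 1 x := fun _ => rfl
  have hgsupp : tsupport (g : EuclideanSpace ℝ (Fin 4) → ℝ) ⊆ Metric.closedBall 0 1 :=
    tsupport_radialCutoff_subset h0 h1
  -- the translate
  set v : EuclideanSpace ℝ (Fin 4) := EuclideanSpace.basisFun (Fin 4) ℝ 0 with hv
  have hvn : ‖v‖ = 1 := (EuclideanSpace.basisFun (Fin 4) ℝ).orthonormal.1 0
  set b : EuclideanSpace ℝ (Fin 4) := (3 : ℝ) • v with hb
  have hbn : ‖b‖ = 3 := by rw [hb, norm_smul, hvn, mul_one, Real.norm_eq_abs, abs_of_pos (by norm_num)]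
  set h : 𝓢(EuclideanSpace ℝ (Fin 4), ℝ) := SchwartzMap.compSubConstCLM ℝ b g with hh
  have hhapp : ∀ x, h x = g (x - b) := fun x => SchwartzMap.compSubConstCLM_apply g b x
  have hhsupp : tsupport (h : EuclideanSpace ℝ (Fin 4) → ℝ) ⊆ Metric.closedBall b 1 := by
    refine closure_minimal (fun x hx => ?_) Metric.isClosed_closedBall
    have hx' : x - b ∈ tsupport (g : EuclideanSpace ℝ (Fin 4) → ℝ) := by
      refine subset_tsupport _ ?_
      rw [Function.mem_support] at hx ⊢
      rwa [hhapp] at hx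
    have := hgsupp hx'
    rwa [Metric.mem_closedBall, dist_eq_norm, ← mem_closedBall_zero_iff]
  -- positivity of the integral of `g`
  have hgpos : 0 < ∫ x, g x := by
    refine (integral_pos_iff_support_of_nonneg (μ := volume) (f := (g : EuclideanSpace ℝ (Fin 4) → ℝ))
      (fun x => radialCutoff_nonneg _ _ _) g.integrable).2 ?_
    refine lt_of_lt_of_le (Metric.measure_ball_pos volume (0 : EuclideanSpace ℝ (Fin 4)) (by norm_num : (0 : ℝ) < 1 / 2))
      (measure_mono fun x hx => ?_)
    rw [Function.mem_support, hgapp, radialCutoff_eq_one h0 h1 (mem_ball_zero_iff.1 hx).le]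
    exact one_ne_zero
  refine ⟨g, h, ?_, hgsupp.trans (Metric.closedBall_subset_closedBall (by norm_num)), ?_, hgpos, ?_⟩
  · refine Set.disjoint_left.2 fun x hxg hxh => ?_
    have h1' := hgsupp hxg
    have h2' := hhsupp hxh
    rw [Metric.mem_closedBall] at h1' h2'
    have h3 : dist (0 : EuclideanSpace ℝ (Fin 4)) b = 3 := by rw [dist_comm, dist_zero_right, hbn]
    linarith [dist_triangle_left (0 : EuclideanSpace ℝ (Fin 4)) b x]
  · intro x hx
    have h2' := hhsupp hx
    rw [Metric.mem_closedBall] at h2' ⊢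
    have h3 : dist b (0 : EuclideanSpace ℝ (Fin 4)) = 3 := by rw [dist_zero_right, hbn]
    linarith [dist_triangle x b (0 : EuclideanSpace ℝ (Fin 4))]
  · have : ∫ x, h x = ∫ x, g x := by
      simp_rw [hhapp]
      exact integral_sub_right_eq_self (fun x => g x) b
    rw [this]; exact hgpos

/-! ## §2 The witness `F = g ⊗ h` on the lattice -/

/-- A lattice site outside `box L` is carried by the spacing `a` outside the ball of radius `4` once `4 < a (L + 1)`. [folklore] -/
theorem norm_smul_siteToE_gt_of_not_mem_box {a : ℝ} (ha : 0 < a) {L : ℕ} (hL : 4 < a * ((L : ℝ) + 1)) {z : Site 4}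
    (hz : z ∉ box 4 L) : 4 < ‖a • siteToE z‖ := by
  rw [mem_box, not_forall] at hz
  obtain ⟨j, hj⟩ := hz
  have hjz : (L : ℤ) + 1 ≤ |z j| := by
    rw [not_and_or, not_le, not_le] at hj
    rcases hj with h | h
    · rw [abs_of_neg (by omega)]; omega
    · rw [abs_of_pos (by omega)]; omega
  have hzr : (L : ℝ) + 1 ≤ |((z j : ℤ) : ℝ)| := by
    have h' : (((L : ℤ) + 1 : ℤ) : ℝ) ≤ ((|z j| : ℤ) : ℝ) := by exact_mod_cast hjz
    simpa [Int.cast_abs] using h'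
  calc (4 : ℝ) < a * ((L : ℝ) + 1) := hL
    _ ≤ a * |((z j : ℤ) : ℝ)| := mul_le_mul_of_nonneg_left hzr ha.le
    _ ≤ a * ‖z‖ := by
        refine mul_le_mul_of_nonneg_left ?_ ha.le
        have h := norm_le_pi_norm z j
        rwa [Int.norm_eq_abs] at h
    _ ≤ ‖a • siteToE z‖ := mul_norm_le_norm_smul_siteToE ha.le z

/-- The tensor witness vanishes at a lattice pair with a point outside `box L`, once `4 < a (L + 1)`. [folklore] -/
theorem tensor_apply_eq_zero_of_not_mem_box {g h : 𝓢(EuclideanSpace ℝ (Fin 4), ℝ)}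
    (hg : tsupport (g : EuclideanSpace ℝ (Fin 4) → ℝ) ⊆ Metric.closedBall 0 4)
    (hh : tsupport (h : EuclideanSpace ℝ (Fin 4) → ℝ) ⊆ Metric.closedBall 0 4)
    {a : ℝ} (ha : 0 < a) {L : ℕ} (hL : 4 < a * ((L : ℝ) + 1)) {x : Fin 2 → Site 4}
    (hx : x ∉ Fintype.piFinset (fun _ : Fin 2 => box 4 L)) :
    SchwartzMap.tensorFin 2 ![ofRealTest g, ofRealTest h] (fun i => a • siteToE (x i)) = 0 := by
  rw [SchwartzMap.tensorFin_apply, Fin.prod_univ_two]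
  simp only [Matrix.cons_val_zero, Matrix.cons_val_one, ofRealTest_apply]
  rw [Fintype.mem_piFinset, not_forall] at hx
  obtain ⟨i, hi⟩ := hx
  have hout : ∀ {f : 𝓢(EuclideanSpace ℝ (Fin 4), ℝ)} {z : Site 4}, z ∉ box 4 L →
      tsupport (f : EuclideanSpace ℝ (Fin 4) → ℝ) ⊆ Metric.closedBall 0 4 → f (a • siteToE z) = 0 := fun hz hf =>
    image_eq_zero_of_notMem_tsupport fun hmem => by
      have h1 := hf hmem
      have h2 := norm_smul_siteToE_gt_of_not_mem_box ha hL hz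
      rw [mem_closedBall_zero_iff] at h1
      linarith
  have hi2 : i = 0 ∨ i = 1 := by fin_cases i <;> simp
  rcases hi2 with rfl | rfl
  · rw [hout hi hg, Complex.ofReal_zero, zero_mul]
  · rw [hout hi hh, Complex.ofReal_zero, mul_zero]

/-- **The lattice sums of the tensor witness factor.** [folklore] -/
theorem sum_piFinset_tensor_eq_mul (g h : 𝓢(EuclideanSpace ℝ (Fin 4), ℝ)) (a : ℝ) (s : Finset (Site 4)) :
    ∑ x ∈ Fintype.piFinset (fun _ : Fin 2 => s),
        SchwartzMap.tensorFin 2 ![ofRealTest g, ofRealTest h] (fun i => a • siteToE (x i)) =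
      (((∑ z ∈ s, g (a • siteToE z) : ℝ)) : ℂ) * (((∑ z ∈ s, h (a • siteToE z) : ℝ)) : ℂ) := by
  have key := Finset.prod_univ_sum (fun _ : Fin 2 => s)
    (fun i z => (![ofRealTest g, ofRealTest h] i) (a • siteToE z))
  simp only [Fin.prod_univ_two, Matrix.cons_val_zero, Matrix.cons_val_one] at key
  simp_rw [SchwartzMap.tensorFin_apply]
  simp only [Fin.prod_univ_two, Matrix.cons_val_zero, Matrix.cons_val_one]
  rw [← key]
  simp only [ofRealTest_apply]
  push_cast
  rfl

/-! ## §3 ★ The `n = 2` clause forces the mean-shift rate -/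

/-- ★ **The `n = 2` recentring clause forces `a⁻⁴·(m_C − m) → 0`.**  See the module docstring, §3. [folklore] -/
theorem tendsto_meanShift_of_dist_two_recentre {G : Type*} [Group G] {N : ℕ} (ρ : G →* Matrix (Fin N) (Fin N) ℂ)
    [TopologicalSpace G] [IsTopologicalGroup G] [CompactSpace G] [MeasurableSpace G] [BorelSpace G]
    (hρ : Continuous ρ) (C : ℕ → PeriodCell 4) (a β m : ℕ → ℝ) (L : ℕ → ℕ)
    (ha : ∀ k, 0 < a k) (ha0 : Tendsto a atTop (𝓝 0)) (haL : Tendsto (fun k => a k * L k) atTop atTop)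
    (hbox : ∀ k, box 4 (L k) ⊆ (C k).reps)
    {O : LGConfig 4 G → ℝ} (hO : Measurable O) {B : ℝ} (hB : ∀ V, |O V| ≤ B)
    (H : ∀ F : 𝓢((Fin 2 → EuclideanSpace ℝ (Fin 4)), ℂ), IsOffDiagonal F →
      HasCompactSupport (F : (Fin 2 → EuclideanSpace ℝ (Fin 4)) → ℂ) →
      Tendsto (fun k => (C k).dist ρ (β k) (fun z => a k • siteToE z) O ((C k).mean ρ (β k) O) 2 F -
        (C k).dist ρ (β k) (fun z => a k • siteToE z) O (m k) 2 F) atTop (𝓝 0)) :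
    Tendsto (fun k => (a k)⁻¹ ^ 4 * ((C k).mean ρ (β k) O - m k)) atTop (𝓝 0) := by
  obtain ⟨g, h, hdisj, hg4, hh4, hgpos, hhpos⟩ := exists_bumpPair
  set F : 𝓢((Fin 2 → EuclideanSpace ℝ (Fin 4)), ℂ) := SchwartzMap.tensorFin 2 ![ofRealTest g, ofRealTest h] with hF
  -- the witness is off-diagonal and compactly supported
  have hFoff : IsOffDiagonal F := by
    refine isOffDiagonal_tensorFin_two_of_disjoint ?_
    rwa [tsupport_ofRealTest, tsupport_ofRealTest]
  have hFcpt : HasCompactSupport (F : (Fin 2 → EuclideanSpace ℝ (Fin 4)) → ℂ) := by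
    refine HasCompactSupport.intro'
      (K := Set.pi Set.univ fun _ : Fin 2 => Metric.closedBall (0 : EuclideanSpace ℝ (Fin 4)) 4)
      (isCompact_univ_pi fun _ => isCompact_closedBall _ _)
      (isClosed_set_pi fun _ _ => Metric.isClosed_closedBall) ?_
    intro x hx
    rw [Set.mem_univ_pi, not_forall] at hx
    obtain ⟨i, hi⟩ := hx
    show SchwartzMap.tensorFin 2 ![ofRealTest g, ofRealTest h] x = 0
    rw [SchwartzMap.tensorFin_apply, Fin.prod_univ_two]
    simp only [Matrix.cons_val_zero, Matrix.cons_val_one, ofRealTest_apply]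
    have hi2 : i = 0 ∨ i = 1 := by fin_cases i <;> simp
    rcases hi2 with rfl | rfl
    · rw [image_eq_zero_of_notMem_tsupport (fun hmem => hi (hg4 hmem)), Complex.ofReal_zero, zero_mul]
    · rw [image_eq_zero_of_notMem_tsupport (fun hmem => hi (hh4 hmem)), Complex.ofReal_zero, mul_zero]
  have hlim := H F hFoff hFcpt
  -- abbreviations: the lattice sums of the witness and the two Riemann sums
  set S : ℕ → ℂ := fun k => ∑ x ∈ Fintype.piFinset (fun _ : Fin 2 => (C k).reps), F (fun i => a k • siteToE (x i))
    with hS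
  set u : ℕ → ℝ := fun k => a k ^ 4 * ∑ z ∈ box 4 (L k), g (a k • siteToE z) with hu
  set w : ℕ → ℝ := fun k => a k ^ 4 * ∑ z ∈ box 4 (L k), h (a k • siteToE z) with hw
  -- the `n = 2` identity: the difference at the witness is `-(δ²)·S`
  have hid : ∀ k, (C k).dist ρ (β k) (fun z => a k • siteToE z) O ((C k).mean ρ (β k) O) 2 F -
      (C k).dist ρ (β k) (fun z => a k • siteToE z) O (m k) 2 F =
      -(((((C k).mean ρ (β k) O - m k) ^ 2 : ℝ) : ℂ) * S k) := fun k =>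
    dist_two_sub_dist_two (C k) ρ hρ (β k) (fun z => a k • siteToE z) hO hB (m k) F
  -- support: eventually the sum over `reps²` is the sum over `box²`, which factors
  have hEL : ∀ᶠ k in atTop, 4 < a k * ((L k : ℝ) + 1) := by
    have h1 : Tendsto (fun k => a k * L k + a k) atTop atTop := haL.atTop_add ha0
    refine (h1.eventually_gt_atTop 4).mono fun k hk => ?_
    linarith
  have hSbox : ∀ᶠ k in atTop, S k =
      (((∑ z ∈ box 4 (L k), g (a k • siteToE z) : ℝ)) : ℂ) * (((∑ z ∈ box 4 (L k), h (a k • siteToE z) : ℝ)) : ℂ) := by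
    filter_upwards [hEL] with k hk
    rw [hS, ← sum_piFinset_tensor_eq_mul g h (a k) (box 4 (L k))]
    exact (Finset.sum_subset (Fintype.piFinset_subset _ _ fun _ => hbox k) fun x _ hx =>
      tensor_apply_eq_zero_of_not_mem_box hg4 hh4 (ha k) hk hx).symm
  -- Riemann sums: `a⁸ ‖S‖ → (∫g)(∫h) > 0`
  have hRg : Tendsto u atTop (𝓝 (∫ x, g x)) := tendsto_riemannSum_box g a L ha ha0 haL
  have hRh : Tendsto w atTop (𝓝 (∫ x, h x)) := tendsto_riemannSum_box h a L ha ha0 haL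
  have hI : 0 < (∫ x, g x) * (∫ x, h x) := mul_pos hgpos hhpos
  have hnormS : Tendsto (fun k => a k ^ 8 * ‖S k‖) atTop (𝓝 ((∫ x, g x) * (∫ x, h x))) := by
    have hprod := (hRg.mul hRh).abs
    rw [abs_of_pos hI] at hprod
    refine hprod.congr' ?_
    filter_upwards [hSbox] with k hk
    rw [hk, norm_mul, Complex.norm_real, Complex.norm_real, Real.norm_eq_abs, Real.norm_eq_abs, hu, hw]
    simp only
    rw [abs_mul, abs_mul, abs_mul, abs_of_pos (pow_pos (ha k) 4)]
    ring
  have hSpos : ∀ᶠ k in atTop, (∫ x, g x) * (∫ x, h x) / 2 < a k ^ 8 * ‖S k‖ :=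
    (tendsto_order.1 hnormS).1 _ (by linarith)
  -- the squared rate times `a⁸‖S‖` is the norm of the difference
  have hsq : ∀ k, ((a k)⁻¹ ^ 4 * ((C k).mean ρ (β k) O - m k)) ^ 2 * (a k ^ 8 * ‖S k‖) =
      ‖(C k).dist ρ (β k) (fun z => a k • siteToE z) O ((C k).mean ρ (β k) O) 2 F -
        (C k).dist ρ (β k) (fun z => a k • siteToE z) O (m k) 2 F‖ := by
    intro k
    rw [hid k, norm_neg, norm_mul, Complex.norm_real, Real.norm_eq_abs, abs_of_nonneg (sq_nonneg _)]
    have h8 : (a k)⁻¹ ^ 8 * a k ^ 8 = 1 := by rw [inv_pow, inv_mul_cancel₀ (pow_ne_zero 8 (ha k).ne')]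
    calc ((a k)⁻¹ ^ 4 * ((C k).mean ρ (β k) O - m k)) ^ 2 * (a k ^ 8 * ‖S k‖)
        = ((a k)⁻¹ ^ 8 * a k ^ 8) * (((C k).mean ρ (β k) O - m k) ^ 2 * ‖S k‖) := by ring
      _ = ((C k).mean ρ (β k) O - m k) ^ 2 * ‖S k‖ := by rw [h8, one_mul]
  -- squeeze the squared rate
  have hv : Tendsto (fun k => ((a k)⁻¹ ^ 4 * ((C k).mean ρ (β k) O - m k)) ^ 2) atTop (𝓝 0) := by
    have hd : Tendsto (fun k => ‖(C k).dist ρ (β k) (fun z => a k • siteToE z) O ((C k).mean ρ (β k) O) 2 F -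
        (C k).dist ρ (β k) (fun z => a k • siteToE z) O (m k) 2 F‖ / ((∫ x, g x) * (∫ x, h x) / 2)) atTop (𝓝 0) := by
      have h0 := hlim.norm
      rw [norm_zero] at h0
      simpa using h0.div_const ((∫ x, g x) * (∫ x, h x) / 2)
    refine squeeze_zero' (Eventually.of_forall fun k => sq_nonneg _) ?_ hd
    filter_upwards [hSpos] with k hk
    rw [le_div_iff₀ (by linarith), ← hsq k]
    exact mul_le_mul_of_nonneg_left hk.le (sq_nonneg _)
  -- and take the square root
  have habs : Tendsto (fun k => |(a k)⁻¹ ^ 4 * ((C k).mean ρ (β k) O - m k)|) atTop (𝓝 0) := by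
    have hsqrt := (Real.continuous_sqrt.tendsto 0).comp hv
    rw [Real.sqrt_zero] at hsqrt
    refine hsqrt.congr fun k => ?_
    simp only [Function.comp_apply, Real.sqrt_sq_eq_abs]
  exact tendsto_zero_iff_norm_tendsto_zero.2 (by simpa only [Real.norm_eq_abs] using habs)

/-! ## §4 ★ In the binders of the route: `CoverRecentring (n = 2)` implies the conclusion of `OnePointRate` -/

/-- ★ **KILL CRITERION of `RecentredCoverTransfer` as a theorem.**  Along any species scheme `sch` and any cells `C_k` with
`box(L_k) ⊆ reps_k`: if the `n = 2` clause of `CoverRecentring` holds (for every off-diagonal compactly supported `F` on `(ℝ⁴)²` the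
own-centred minus torus-mean-centred two-point cell distributions tend to `0`), then the conclusion of `OnePointRate` holds:
`a_k⁻⁴·(wilsonTorusMean(β_k, L_k) − m_{C_k}) → 0`.  Contrapositive: a scheme along which the cover-minus-torus plaquette mean is NOT
`o(a_k⁴)` refutes `CoverRecentring`. [folklore] -/
theorem onePointRate_conclusion_of_coverRecentring_two {G : Type} [Group G] [TopologicalSpace G] [IsTopologicalGroup G]
    [CompactSpace G] [MeasurableSpace G] [BorelSpace G] (r : LatticeRep G) (sch : SpeciesScheme (YMSpecies G))
    (C : ℕ → PeriodCell 4) (hbox : ∀ k, box 4 (sch.L k) ⊆ (C k).reps)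
    (H : ∀ F : 𝓢((Fin 2 → EuclideanSpace ℝ (Fin 4)), ℂ), IsOffDiagonal F →
      HasCompactSupport (F : (Fin 2 → EuclideanSpace ℝ (Fin 4)) → ℂ) →
      Tendsto (fun k => (C k).dist r.ρ (sch.β k) (fun z => (sch.a k) • siteToE z) r.curvature.F
          ((C k).mean r.ρ (sch.β k) r.curvature.F) 2 F -
        (C k).dist r.ρ (sch.β k) (fun z => (sch.a k) • siteToE z) r.curvature.F
          (wilsonTorusMean r.ρ (sch.β k) (sch.L k) r.curvature.F) 2 F) atTop (𝓝 0)) :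
    Tendsto (fun k => ((sch.a k)⁻¹) ^ 4 *
      (wilsonTorusMean r.ρ (sch.β k) (sch.L k) r.curvature.F - (C k).mean r.ρ (sch.β k) r.curvature.F)) atTop (𝓝 0) := by
  obtain ⟨B, hB⟩ := r.curvature.bounded
  have h := (tendsto_meanShift_of_dist_two_recentre r.ρ r.continuous C sch.a sch.β
    (fun k => wilsonTorusMean r.ρ (sch.β k) (sch.L k) r.curvature.F) sch.L sch.a_pos sch.tendsto_a sch.tendsto_L hbox
    r.curvature.measurable hB H).neg
  rw [neg_zero] at h
  refine h.congr fun k => ?_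
  ring

end Summit.QuantumFields.YangMills.Theorems.RecentredCoverTransfer

end
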